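import Summits.BirchSwinnertonDyer.BirchSwinnertonDyer.Theorems.ThetaPartnerAtTwoSignedMainConjectureCMTwoRankZeroLengthCurrency
import Summits.BirchSwinnertonDyer.BirchSwinnertonDyer.Theorems.ThetaPartnerAtTwoSignedMainConjectureCMTwoRankZeroPollackPairUnique
import HarnessLib

/-!
# Route `ThetaPartnerAtTwo` (TP2), crux K2r0P `SignedMainConjectureCMTwoRankZeroOfPub` (stmt-BirchSwinnertonDyer-24945),
# line `rankzero` v14: LENGTH-CURRENCY DOORS at `p = 2` — the registered stub (LD±2^k)_A, the promote text D_MC and the crux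
# BODY from local lengths at the height-one primes `𝔭 ∌ 2`

HONEST FRAMING (cell `pub/bsd-wall`, W-ALL row 1, lead prover `bsd-wall-tp2-p2` g8, 2026-08-28). Nothing here is the crux and
BSD is not proved by any of this. Sibling `…LengthCurrency.lean` proved, for any `p`, sign and torsion dual datum, that the LOWER
shape of the registered stub is «`ℓ_𝔭(Λ/(L)) ≤ ℓ_𝔭(X^ε)` off `p`» and the TWO-SIDED shape of D_MC is «`ℓ_𝔭(X^ε) = ℓ_𝔭(Λ/(L))`
off `p`». Here, at `p = 2` on the crux's class (CM `A/ℚ`, analytic rank `0`, good supersingular at `2`, `a₂ = 0`, off the unit zone),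
with the lineage's uniqueness doors («one `ϖ`, one Pollack pair at `2` suffice», `…PollackPairUnique.lean`):
* `signedLowerDivisibilityUpToTwoPowerNonUnitCMTwo_of_lengthLe` — the REGISTERED stub `stub_signedLowerDivisibilityUpToTwoPowerNonUnitCMTwo`
  of `Cruxes/SignedMainConjectureCMTwoRankZeroOfPub/Lines/rankzero.lean` VERBATIM from «(LD-len)_A»;
* `signedUpToTwoPowerNonUnitCMTwo_exists_of_lengthEq` — D_MC in the «∃ one datum» form (the hypothesis of
  `signedUpToTwoPowerNonUnitCMTwo_of_exists`) from «(MC-len)_A»: `X⁺` torsion and `ℓ_𝔭(X⁺) = ℓ_𝔭(Λ/(L♭))` at every height-one `𝔭 ∌ 2`;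
* `signedMainConjectureCMTwoRankZero_body_of_pub_of_lengthEq_of_flat` — PUB¹⁰ + (MC-len)_A + (μ♭)_A ⇒ the crux BODY.
So a port running in the K3 seats' length currency (`lengthAt`, `Kato2004.IwasawaH1Data`, four-term length (in)equalities at
`𝔭 ∌ 2`; architecture (P1)–(P4) of `Cruxes/…/ER2-PRINT-SOURCE-w2.md` §5) ends EXACTLY on the crux's hypotheses. (MC-len)_A is a
PORT of print (Kato 2004 Prop. 15.9, Lemma 15.13 away from `(2)`, Johnson-Leung–Kings 2011 Thm. 5.2); (μ♭)_A is open class-wide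
(instances of Perrin-Riou's `μ^± = 0`); nothing about any curve is asserted here.

References: [Kato2004Asterisque] Prop. 15.9 (p. 258), Lemma 15.13 (p. 264); [JohnsonLeungKings2011] Thm. 5.2;
[Kobayashi2003] Thm. 1.3 (i) (p. 2); [PollackRubin2004] Thm. 7.3 (p > 2); [BurungaleFlach2024] Thm. 1.1.
-/

set_option autoImplicit false
-- the Theorems namespace of this sub repeats the summit name by design (D-0017 nested layout)
set_option linter.dupNamespace false

noncomputable section

open scoped Classical MatrixGroups ModularForm

open CongruenceSubgroup WeierstrassCurve Literature.NumberTheory.EllipticCurves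
  Literature.NumberTheory.EllipticCurves.ModularForms Literature.NumberTheory.EllipticCurves.Module
  Literature.NumberTheory.EllipticCurves.Rank1Residual
  Literature.NumberTheory.EllipticCurves.Kobayashi2003 ZpExtension
  Summit.BirchSwinnertonDyer.Rank1Residual.Supersingular

namespace Summit.BirchSwinnertonDyer.BirchSwinnertonDyer.Theorems

namespace SignedLengthDoors

/-! ## §2 `p = 2`, the crux's class: the registered stub and the promote text D_MC from the length currency -/

section AtTwo

/-- `L♭ = kobayashiL 1 L♯ L♭` of a Pollack pair is non-zero (carried by `IsPollackPair`). [cite: Pollack2003, Cor. 5.11] -/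
private theorem kobayashiL_one_ne_zero {N : ℕ} [NeZero N] {f : CuspForm (Gamma0 N) 2}
    {Lplus Lminus : IwasawaAlgebra 2} (hPP : IsPollackPair f 2 Lplus Lminus) : kobayashiL 1 Lplus Lminus ≠ 0 := by
  rw [kobayashiL, if_pos rfl]; exact hPP.2.1

/-- **The registered stub (LD±2^k)_A VERBATIM from the length currency**: if for every class member off the unit zone, every
normalised cyclotomic datum and every newform `f` there are ONE period ratio `ϖ` and ONE Pollack pair at `2` such that every dual datum
`D` of `Sel⁺(A/ℚ_∞)` is torsion with `ℓ_𝔭(Λ/(L♭)) ≤ ℓ_𝔭(X⁺)` at every height-one `𝔭 ∌ 2`, then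
`stub_signedLowerDivisibilityUpToTwoPowerNonUnitCMTwo` holds (§1 + the uniqueness door
`signedLowerDivisibilityUpToTwoPowerNonUnitCMTwo_of_exists`). [cite: Kobayashi2003, Thm. 1.3 (i) (p. 2)]
[cite: Kato2004Asterisque, Prop. 15.9 (p. 258) and Lemma 15.13 (p. 264)] -/
theorem signedLowerDivisibilityUpToTwoPowerNonUnitCMTwo_of_lengthLe
    (h : ∀ (A : WeierstrassCurve ℚ) [A.IsElliptic] [A.IsGloballyMinimal],
      A.HasCM → A.analyticRank = 0 → GoodSS A 2 → A.frobeniusTrace 2 = 0 →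
      2 ∣ A.shaOrder * A.tamagawaProduct →
      ∀ (κ : ZpExtension ℚ 2) (γ : Field.absoluteGaloisGroup ℚ),
        κ.IsCyclotomic → κ.IsTopGenerator γ → IsCyclotomicVariable 2 γ →
      ∀ [NeZero (A.conductorNorm ℤ)] (f : CuspForm (Gamma0 (A.conductorNorm ℤ)) 2), IsNewformOf A f →
      ∃ (ϖ : ℚ) (Lplus Lminus : IwasawaAlgebra 2), (ϖ : ℝ) * A.realPeriodRat = plusPeriod f ∧
        IsPollackPair f 2 Lplus Lminus ∧
        ∀ (D : SignedSelmerDualData A κ γ 1), Module.IsTorsion (IwasawaAlgebra 2) D.X ∧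
          ∀ 𝔭 : PrimeSpectrum (IwasawaAlgebra 2), 𝔭.asIdeal.height = 1 →
            PowerSeries.C (2 : ℤ_[2]) ∉ 𝔭.asIdeal →
            lengthAt (IwasawaAlgebra 2) (IwasawaAlgebra 2 ⧸ Ideal.span {kobayashiL 1 Lplus Lminus}) 𝔭 ≤
              lengthAt (IwasawaAlgebra 2) D.X 𝔭) :
    ∀ (A : WeierstrassCurve ℚ) [A.IsElliptic] [A.IsGloballyMinimal],
      A.HasCM → A.analyticRank = 0 → GoodSS A 2 → A.frobeniusTrace 2 = 0 →
      2 ∣ A.shaOrder * A.tamagawaProduct →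
      ∀ (κ : ZpExtension ℚ 2) (γ : Field.absoluteGaloisGroup ℚ),
        κ.IsCyclotomic → κ.IsTopGenerator γ → IsCyclotomicVariable 2 γ →
      ∀ [NeZero (A.conductorNorm ℤ)] (f : CuspForm (Gamma0 (A.conductorNorm ℤ)) 2),
        IsNewformOf A f → ∀ (ϖ : ℚ), (ϖ : ℝ) * A.realPeriodRat = plusPeriod f →
      ∀ (Lplus Lminus : IwasawaAlgebra 2), IsPollackPair f 2 Lplus Lminus →
      ∀ (D : SignedSelmerDualData A κ γ 1),
        ∃ (g h : IwasawaAlgebra 2) (m m' : ℕ), D.charIdeal = Ideal.span {g} ∧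
          PowerSeries.C ((2 : ℚ_[2]) ^ m') * iwasawaToPowerSeries 2 g =
            PowerSeries.C ((2 : ℚ_[2]) ^ m * (ϖ : ℚ_[2])) * iwasawaToPowerSeries 2 (kobayashiL 1 Lplus Lminus * h) := by
  refine signedLowerDivisibilityUpToTwoPowerNonUnitCMTwo_of_exists fun A _ _ hcm hr hss ha hz κ γ hκ hγ hcv _ f hf ↦ ?_
  obtain ⟨ϖ, Lplus, Lminus, hϖ, hPP, hD⟩ := h A hcm hr hss ha hz κ γ hκ hγ hcv f hf
  refine ⟨ϖ, Lplus, Lminus, hϖ, hPP, fun D ↦ ?_⟩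
  obtain ⟨hX, hlen⟩ := hD D
  have e := exists_lowerUpTo_of_lengthAt_le (p := 2) hγ D (kobayashiL_one_ne_zero hPP)
    (SignedKatoOffTwo.varpi_ne_zero hf hϖ) hX hlen
  simpa using e

/-- **D_MC (the two-sided promote text, «∃ one datum» form = the hypothesis of `signedUpToTwoPowerNonUnitCMTwo_of_exists`)
from (MC-len)_A**: one `ϖ`, one Pollack pair at `2`, every dual datum of `Sel⁺(A/ℚ_∞)` torsion with `ℓ_𝔭(X⁺) = ℓ_𝔭(Λ/(L♭))` at
every height-one `𝔭 ∌ 2` — the natural END of a port running in the K3 seats' length currency (Kato 15.9 / Lemma 15.13 off `(2)` /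
JLK Thm. 5.2). [cite: Kato2004Asterisque, Prop. 15.9 (p. 258) and Lemma 15.13 (p. 264)] [cite: JohnsonLeungKings2011, Thm. 5.2]
[cite: PollackRubin2004, Thm. 7.3 (p > 2)] -/
theorem signedUpToTwoPowerNonUnitCMTwo_exists_of_lengthEq
    (h : ∀ (A : WeierstrassCurve ℚ) [A.IsElliptic] [A.IsGloballyMinimal],
      A.HasCM → A.analyticRank = 0 → GoodSS A 2 → A.frobeniusTrace 2 = 0 →
      2 ∣ A.shaOrder * A.tamagawaProduct →
      ∀ (κ : ZpExtension ℚ 2) (γ : Field.absoluteGaloisGroup ℚ),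
        κ.IsCyclotomic → κ.IsTopGenerator γ → IsCyclotomicVariable 2 γ →
      ∀ [NeZero (A.conductorNorm ℤ)] (f : CuspForm (Gamma0 (A.conductorNorm ℤ)) 2), IsNewformOf A f →
      ∃ (ϖ : ℚ) (Lplus Lminus : IwasawaAlgebra 2), (ϖ : ℝ) * A.realPeriodRat = plusPeriod f ∧
        IsPollackPair f 2 Lplus Lminus ∧
        ∀ (D : SignedSelmerDualData A κ γ 1), Module.IsTorsion (IwasawaAlgebra 2) D.X ∧
          ∀ 𝔭 : PrimeSpectrum (IwasawaAlgebra 2), 𝔭.asIdeal.height = 1 →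
            PowerSeries.C (2 : ℤ_[2]) ∉ 𝔭.asIdeal →
            lengthAt (IwasawaAlgebra 2) D.X 𝔭 =
              lengthAt (IwasawaAlgebra 2) (IwasawaAlgebra 2 ⧸ Ideal.span {kobayashiL 1 Lplus Lminus}) 𝔭) :
    ∀ (A : WeierstrassCurve ℚ) [A.IsElliptic] [A.IsGloballyMinimal],
      A.HasCM → A.analyticRank = 0 → GoodSS A 2 → A.frobeniusTrace 2 = 0 →
      2 ∣ A.shaOrder * A.tamagawaProduct →
      ∀ (κ : ZpExtension ℚ 2) (γ : Field.absoluteGaloisGroup ℚ),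
        κ.IsCyclotomic → κ.IsTopGenerator γ → IsCyclotomicVariable 2 γ →
      ∀ [NeZero (A.conductorNorm ℤ)] (f : CuspForm (Gamma0 (A.conductorNorm ℤ)) 2), IsNewformOf A f →
      ∃ (ϖ : ℚ) (Lplus Lminus : IwasawaAlgebra 2), (ϖ : ℝ) * A.realPeriodRat = plusPeriod f ∧
        IsPollackPair f 2 Lplus Lminus ∧
        ∀ (D : SignedSelmerDualData A κ γ 1),
          ∃ (g : IwasawaAlgebra 2) (m m' : ℕ), D.charIdeal = Ideal.span {g} ∧
            PowerSeries.C ((2 : ℚ_[2]) ^ m') * iwasawaToPowerSeries 2 g =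
              PowerSeries.C ((2 : ℚ_[2]) ^ m * (ϖ : ℚ_[2])) * iwasawaToPowerSeries 2 (kobayashiL 1 Lplus Lminus) := by
  intro A _ _ hcm hr hss ha hz κ γ hκ hγ hcv _ f hf
  obtain ⟨ϖ, Lplus, Lminus, hϖ, hPP, hD⟩ := h A hcm hr hss ha hz κ γ hκ hγ hcv f hf
  refine ⟨ϖ, Lplus, Lminus, hϖ, hPP, fun D ↦ ?_⟩
  obtain ⟨hX, hlen⟩ := hD D
  exact exists_upTo_of_lengthAt_eq (p := 2) hγ D (kobayashiL_one_ne_zero hPP)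
    (SignedKatoOffTwo.varpi_ne_zero hf hϖ) hX hlen

/-- **The crux BODY from PUB¹⁰ + (MC-len)_A + (μ♭)_A** (composition through the uniqueness doors of the lineage and
`signedMainConjectureCMTwoRankZero_body_of_pub_of_upToTwoPower_of_flat`): for every CM `A/ℚ` (globally minimal) of analytic rank `0`,
good supersingular at `2`, `a₂ = 0`, `X⁺(A/ℚ_∞)` torsion with `μ⁺ = 0` at every cyclotomic top-generator pair, and
`KobayashiMainConjecture A 2 1`. The two displayed research binders are (MC-len)_A — a PORT of print (Kato 2004 Prop. 15.9, Lemma 15.13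
off `(2)`, Johnson-Leung–Kings 2011 Thm. 5.2) — and the registered (μ♭)_A (open class-wide: instances of Perrin-Riou's `μ^± = 0`).
[cite: Kato2004Asterisque, Prop. 15.9 (p. 258) and Lemma 15.13 (p. 264)] [cite: JohnsonLeungKings2011, Thm. 5.2]
[cite: BurungaleFlach2024, Thm. 1.1] [cite: PollackRubin2004, Thm. 7.3 (p > 2)] -/
theorem signedMainConjectureCMTwoRankZero_body_of_pub_of_lengthEq_of_flat
    (hBF : bsdTriple_of_hasCM_of_L_one_ne_zero)
    (hmod : nonempty_modularParametrizationData) (hLrat : hasEntireLFunction_rat)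
    (hGZK : rank_eq_analyticRank_of_analyticRank_le_one)
    (h2 : Literature.NumberTheory.EllipticCurves.realPeriodRat_eq_unit_mul_plusPeriod_two)
    (hC : Greenberg1999.casselsSurjectivity_H1Sigma ℚ)
    (h412 : Greenberg1999.prop412_noFiniteSubmodule_H1Sigma_of_rank_one)
    (hcork : Greenberg1999.h1Sigma_zpCorank_le_degree ℚ)
    (hP108 : Greenberg1999.localQuotient_restriction_surjective ℚ)
    (hWL : Greenberg1999.h1SigmaInfty_rank_eq_one)
    (hlen : ∀ (A : WeierstrassCurve ℚ) [A.IsElliptic] [A.IsGloballyMinimal],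
      A.HasCM → A.analyticRank = 0 → GoodSS A 2 → A.frobeniusTrace 2 = 0 →
      2 ∣ A.shaOrder * A.tamagawaProduct →
      ∀ (κ : ZpExtension ℚ 2) (γ : Field.absoluteGaloisGroup ℚ),
        κ.IsCyclotomic → κ.IsTopGenerator γ → IsCyclotomicVariable 2 γ →
      ∀ [NeZero (A.conductorNorm ℤ)] (f : CuspForm (Gamma0 (A.conductorNorm ℤ)) 2), IsNewformOf A f →
      ∃ (ϖ : ℚ) (Lplus Lminus : IwasawaAlgebra 2), (ϖ : ℝ) * A.realPeriodRat = plusPeriod f ∧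
        IsPollackPair f 2 Lplus Lminus ∧
        ∀ (D : SignedSelmerDualData A κ γ 1), Module.IsTorsion (IwasawaAlgebra 2) D.X ∧
          ∀ 𝔭 : PrimeSpectrum (IwasawaAlgebra 2), 𝔭.asIdeal.height = 1 →
            PowerSeries.C (2 : ℤ_[2]) ∉ 𝔭.asIdeal →
            lengthAt (IwasawaAlgebra 2) D.X 𝔭 =
              lengthAt (IwasawaAlgebra 2) (IwasawaAlgebra 2 ⧸ Ideal.span {kobayashiL 1 Lplus Lminus}) 𝔭)
    (hμ : ∀ (A : WeierstrassCurve ℚ) [A.IsElliptic] [A.IsGloballyMinimal],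
      A.HasCM → A.analyticRank = 0 → GoodSS A 2 → A.frobeniusTrace 2 = 0 →
      2 ∣ A.shaOrder * A.tamagawaProduct →
      ∀ [NeZero (A.conductorNorm ℤ)] (f : CuspForm (Gamma0 (A.conductorNorm ℤ)) 2),
      IsNewformOf A f → ∀ (Lplus Lminus : IwasawaAlgebra 2), IsPollackPair f 2 Lplus Lminus →
        ∃ n : ℕ, IsUnit (PowerSeries.coeff n (kobayashiL 1 Lplus Lminus)))
    (A : WeierstrassCurve ℚ) [A.IsElliptic] [A.IsGloballyMinimal]
    (hcm : A.HasCM) (hr : A.analyticRank = 0) (hss : GoodSS A 2) (ha : A.frobeniusTrace 2 = 0) :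
    (∀ (κ : ZpExtension ℚ 2) (γ : Field.absoluteGaloisGroup ℚ), κ.IsCyclotomic → κ.IsTopGenerator γ →
      ∀ D : SignedSelmerDualData A κ γ 1, Module.IsTorsion (IwasawaAlgebra 2) D.X ∧ D.mu = 0) ∧
    KobayashiMainConjecture A 2 1 :=
  signedMainConjectureCMTwoRankZero_body_of_pub_of_upToTwoPower_of_flat hBF hmod hLrat hGZK h2 hC h412 hcork hP108 hWL
    (signedUpToTwoPowerNonUnitCMTwo_of_exists (signedUpToTwoPowerNonUnitCMTwo_exists_of_lengthEq hlen)) hμ A hcm hr hss ha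

end AtTwo

end SignedLengthDoors

end Summit.BirchSwinnertonDyer.BirchSwinnertonDyer.Theorems

end
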